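import Summits.QuantumFields.YangMills.Theorems.LuscherReductionTwistedTraceScalingOneSiteInner
import Summits.QuantumFields.YangMills.Theorems.FemtoCutoffLadderFixedLatticeLawInnerRateCopies
import HarnessLib

/-!
# ★★ The ONE-SITE inner no-intruder WITH RATE (`e^{λ_b²}` for `e^{ελ_b}`): the spectral input of the SLOW-WITH-RATE clause of the rate-grade Born–Oppenheimer package
# (route `FlatTubeReduction`, crux K1 `NearFlatRatioLaw` stmt-QuantumFields-24720; seat `ym-line-ftr-p1` g9; rate twin of lane A's `innerNoIntruderOneOrbitAt_one` p642257)

The SLOW clause of `RateTube.SoftTubeBORatePackageOn` (`Theorems/FlatTubeReductionSoftTubeRate.lean`, p648741) is proved, as in lane A's `slow_clause_of_bricks` (p647299), from the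
colour average + the kernel brick (B-T) + a ONE-SITE spectral statement; at rate grade that statement must itself be rate-grade: every `(k+1)`-family of bounded measurable
gauge(=`Ad`)-invariant one-site functions supported in `{orbitDist < δ}` (not twist-invariant) with nondegenerate Gram matrix has a nonzero combination with
`⟨ψ,K_βψ⟩·μ₀ ≤ e^{C·λ_b(β)²}·μ_k·μ₀·‖ψ‖²`.  Crux ONE's levels are two-sided at rate grade, so lane A's proof goes through VERBATIM with `ε := λ_b` and the `λ_b²` cross-term bound
`crossBound_eventually_small_sq` (FCL p599xxx) for `crossBound_eventually_small`:
* ★★ `RateTube.oneOrbitRate_one` — with `C = 1`, for every scale `δ` eventually `≤ 1/2`; the conclusion is literally the hypothesis `hI1` of FCL's `innerRate_of_oneOrbitRate` at `L = 1`.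
HONEST FRAMING: a one-site (finite-dimensional) statement, consequence of the PROVED crux ONE; an input of the rate twin, not the rate twin; not a gap, not Clay.  No defs, no `sorry`.
-/

set_option autoImplicit false

noncomputable section

open MeasureTheory Filter Topology Real
open scoped BigOperators
open Literature.MathematicalPhysics.QuantumFieldTheory
open Literature.MathematicalPhysics.QuantumLattice

namespace Summit.QuantumFields.YangMills.Theorems.FemtoTransferGap

namespace RateTube

open Summit.QuantumFields.YangMills.Theorems.FemtoCutoffLadder

/-- ★★ **THE ONE-SITE INNER NO-INTRUDER WITH RATE** (`C = 1`): for every scale `δ` with `δ β ≤ 1/2` eventually, every `(k+1)`-family of bounded measurable gauge-invariant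
one-site functions supported in `{orbitDist < δ β}` with nondegenerate Gram matrix has a nonzero combination `ψ` with
`⟨ψ, K_βψ⟩·μ₀(1³β) ≤ e^{λ_b(1³β)²}·μ_k(1³β)·λ₀(β,1)·‖ψ‖²` — the hypothesis `hI1` of `innerRate_of_oneOrbitRate` at `L = 1`.  Proof = lane A's `innerNoIntruderOneOrbitAt_one`
with `ε := λ_b`: `twistSum` (physical, `‖·‖² × 8`, form `× 8` up to `56·crossBound·‖·‖²`), the upper Courant–Fischer door at `s = e^{λ_b²/2}μ_k > μ_k`, cross terms `≤ λ_b²λ₀/28`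
eventually (`crossBound_eventually_small_sq`), endgame `oneSite_inner_endgame`. [cite: Luscher1983, §2] [cite: ReedSimonIV1978, Thm. XIII.1] -/
theorem oneOrbitRate_one (k : ℕ) {δ : ℝ → ℝ} (hδL : ∃ β1 : ℝ, ∀ β : ℝ, β1 ≤ β → δ β ≤ 1 / 2) :
    ∃ C₁ βI : ℝ, ∀ β : ℝ, βI ≤ β →
      ∀ G : Fin (k + 1) → (GaugeConfig 3 1 SU2 → ℝ),
        (∀ i, Measurable (G i)) → (∀ i, ∃ C : ℝ, ∀ U, |G i U| ≤ C) →
        (∀ i (g : Site 3 1 → SU2) (U : GaugeConfig 3 1 SU2), G i (gaugeTransform g U) = G i U) →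
        (∀ i U, G i U ≠ 0 → orbitDist U < δ β) →
        (∀ a : Fin (k + 1) → ℝ, a ≠ 0 → 0 < l2 (fun U => ∑ i, a i * G i U) (fun U => ∑ i, a i * G i U)) →
          ∃ a : Fin (k + 1) → ℝ, a ≠ 0 ∧
            qform su2Rep β (fun U => ∑ i, a i * G i U) (fun U => ∑ i, a i * G i U) * levelValue su2Rep 1 (((1 : ℕ) : ℝ) ^ 3 * β) 0 ≤
              Real.exp (C₁ * bareLambda (((1 : ℕ) : ℝ) ^ 3 * β) ^ 2) * levelValue su2Rep 1 (((1 : ℕ) : ℝ) ^ 3 * β) k * levelValue su2Rep 1 β 0 *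
                l2 (fun U => ∑ i, a i * G i U) (fun U => ∑ i, a i * G i U) := by
  obtain ⟨C1, B0, hONE⟩ := oneSiteLevels_proof k
  obtain ⟨β1, hδ1⟩ := hδL
  obtain ⟨βs, hs⟩ := crossBound_eventually_small_sq (L := 1) (m := 1 / 2) (by norm_num) one_pos
  have hτ0 : 0 < 1 / (2 * (|levelGap k| + |C1| + 2)) := by positivity
  refine ⟨1, max (max (max 1 B0) β1) (max βs (2 / (1 / (2 * (|levelGap k| + |C1| + 2))) ^ 3)), fun β hβ => ?_⟩
  have hβ1 : 1 ≤ β := (((le_max_left _ _).trans (le_max_left _ _)).trans (le_max_left _ _)).trans hβ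
  have hβ0 : 0 < β := by linarith
  have hβB0 : B0 ≤ β := (((le_max_right _ _).trans (le_max_left _ _)).trans (le_max_left _ _)).trans hβ
  have hβd : β1 ≤ β := ((le_max_right _ _).trans (le_max_left _ _)).trans hβ
  have hβs : βs ≤ β := ((le_max_left _ _).trans (le_max_right _ _)).trans hβ
  have hβτ : 2 / (1 / (2 * (|levelGap k| + |C1| + 2))) ^ 3 ≤ β := ((le_max_right _ _).trans (le_max_right _ _)).trans hβ
  intro G hGm hGb hGg hGs hGram
  -- scales at one site: `L = 1`, `m = 1/2`
  have hδ2 : δ β ≤ 1 / 2 := hδ1 β hβd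
  have hLδ : ((1 : ℕ) : ℝ) * δ β < 2 := by rw [Nat.cast_one, one_mul]; linarith
  have hLm : ((1 : ℕ) : ℝ) * (δ β + 1 / 2) < 2 := by rw [Nat.cast_one, one_mul]; linarith
  -- one-site data (`(1:ℝ)^3 * β = β`)
  have hB : ((1 : ℕ) : ℝ) ^ 3 * β = β := by rw [Nat.cast_one, one_pow, one_mul]
  obtain ⟨hμ0, -, hμk⟩ := hONE (((1 : ℕ) : ℝ) ^ 3 * β) (by rw [hB]; exact hβB0)
  have hlam0 : 0 < bareLambda (((1 : ℕ) : ℝ) ^ 3 * β) := bareLambda_pos' (by rw [hB]; exact hβ0)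
  have hlamτ := bareLambda_cube_le (L := 1) hτ0 hβτ
  obtain ⟨-, -, hy⟩ := smallness_of_le hlam0.le hlamτ
  have hμk' : Real.exp (-(levelGap k * bareLambda (((1 : ℕ) : ℝ) ^ 3 * β) + |C1| * bareLambda (((1 : ℕ) : ℝ) ^ 3 * β) ^ 2)) *
      levelValue su2Rep 1 (((1 : ℕ) : ℝ) ^ 3 * β) 0 ≤ levelValue su2Rep 1 (((1 : ℕ) : ℝ) ^ 3 * β) k := by
    refine le_trans (mul_le_mul_of_nonneg_right (Real.exp_le_exp.2 ?_) hμ0.le) hμk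
    have := mul_le_mul_of_nonneg_right (le_abs_self C1) (sq_nonneg (bareLambda (((1 : ℕ) : ℝ) ^ 3 * β)))
    linarith
  have hμk2 := half_le_of_exp_lower hy hμ0.le hμk'
  have hμkpos : 0 < levelValue su2Rep 1 (((1 : ℕ) : ℝ) ^ 3 * β) k := lt_of_lt_of_le (half_pos hμ0) hμk2
  have hΛ0 : levelValue su2Rep 1 β 0 = levelValue su2Rep 1 (((1 : ℕ) : ℝ) ^ 3 * β) 0 := by rw [hB]
  have hsc : 28 * crossBound 1 β (1 / 2) ≤
      bareLambda (((1 : ℕ) : ℝ) ^ 3 * β) * bareLambda (((1 : ℕ) : ℝ) ^ 3 * β) * levelValue su2Rep 1 (((1 : ℕ) : ℝ) ^ 3 * β) 0 := by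
    have h := (hs β hβs).trans (mul_le_mul_of_nonneg_left (levelValue_zero_ge_uniform (L := 1) hβ1) (by positivity))
    rw [hΛ0] at h
    have e : 1 * bareLambda (((1 : ℕ) : ℝ) ^ 3 * β) ^ 2 = bareLambda (((1 : ℕ) : ℝ) ^ 3 * β) * bareLambda (((1 : ℕ) : ℝ) ^ 3 * β) := by ring
    rwa [e] at h
  -- the physical family `F = twistSum ∘ G`
  choose C hC using hGb
  have hφm : ∀ a : Fin (k + 1) → ℝ, Measurable fun U => ∑ i, a i * G i U := fun a => Finset.measurable_sum _ fun i _ => (hGm i).const_mul _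
  have hφb : ∀ (a : Fin (k + 1) → ℝ) U, |∑ i, a i * G i U| ≤ ∑ i, |a i| * C i := fun a U =>
    (Finset.abs_sum_le_sum_abs _ _).trans (Finset.sum_le_sum fun i _ => by rw [abs_mul]; exact mul_le_mul_of_nonneg_left (hC i U) (abs_nonneg _))
  have hφg : ∀ (a : Fin (k + 1) → ℝ) (g : Site 3 1 → SU2) U, (∑ i, a i * G i (gaugeTransform g U)) = ∑ i, a i * G i U := fun a g U =>
    Finset.sum_congr rfl fun i _ => by rw [hGg]
  have hφs : ∀ (a : Fin (k + 1) → ℝ) U, ∑ i, a i * G i U ≠ 0 → orbitDist U < δ β := fun a U h => by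
    by_contra hlt
    exact h (Finset.sum_eq_zero fun i _ => by
      have : G i U = 0 := by by_contra hi; exact hlt (hGs i U hi)
      rw [this, mul_zero])
  set F : Fin (k + 1) → GaugeConfig 3 1 SU2 → ℝ := fun i => twistSum (G i) with hFdef
  have hF : ∀ i, IsPhys (F i) := fun i => isPhys_twistSum (hGm i) ⟨C i, hC i⟩ (hGg i)
  have hcomb : ∀ a : Fin (k + 1) → ℝ, (fun U => ∑ i, a i * F i U) = twistSum (fun U => ∑ i, a i * G i U) := fun a => by
    rw [twistSum_sum_mul]
  have hl2 : ∀ a : Fin (k + 1) → ℝ, l2 (fun U => ∑ i, a i * F i U) (fun U => ∑ i, a i * F i U) =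
      8 * l2 (fun U => ∑ i, a i * G i U) (fun U => ∑ i, a i * G i U) := fun a => by
    rw [hcomb a]; exact l2_twistSum (hφm a) (hφb a) hLδ (hφs a)
  have hq : ∀ a : Fin (k + 1) → ℝ, 8 * qform su2Rep β (fun U => ∑ i, a i * G i U) (fun U => ∑ i, a i * G i U) -
      56 * (crossBound 1 β (1 / 2) * l2 (fun U => ∑ i, a i * G i U) (fun U => ∑ i, a i * G i U)) ≤
        qform su2Rep β (fun U => ∑ i, a i * F i U) (fun U => ∑ i, a i * F i U) := fun a => by
    rw [hcomb a]
    have h := abs_qform_twistSum_sub_le hβ0.le (hφm a) (hφb a) (by norm_num : (0 : ℝ) ≤ 1 / 2) hLm (hφs a)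
    rw [abs_le] at h
    linarith [h.1]
  have hFpos : ∀ a : Fin (k + 1) → ℝ, a ≠ 0 → 0 < l2 (fun U => ∑ i, a i * F i U) (fun U => ∑ i, a i * F i U) := fun a ha => by
    rw [hl2 a]; linarith [hGram a ha]
  -- the Courant–Fischer door at `s = e^{λ_b²/2} μ_k > λ_k(β,1)`
  set s : ℝ := Real.exp (bareLambda (((1 : ℕ) : ℝ) ^ 3 * β) / 2 * bareLambda (((1 : ℕ) : ℝ) ^ 3 * β)) *
    levelValue su2Rep 1 (((1 : ℕ) : ℝ) ^ 3 * β) k with hsdef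
  have hks : levelValue su2Rep 1 β k < s := by
    rw [hsdef, ← hB]
    rw [hB]
    have h1 : 1 < Real.exp (bareLambda (((1 : ℕ) : ℝ) ^ 3 * β) / 2 * bareLambda (((1 : ℕ) : ℝ) ^ 3 * β)) := Real.one_lt_exp_iff.mpr (by positivity)
    have hpos' : 0 < levelValue su2Rep 1 β k := by rw [← hB]; exact hμkpos
    rw [hB] at h1 ⊢
    nlinarith
  obtain ⟨a, ha, hlt⟩ := exists_coeff_rayleigh_lt_of_levelValue_lt hks F hF hFpos
  refine ⟨a, ha, ?_⟩
  rw [hl2 a] at hlt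
  rw [hΛ0]
  have key := oneSite_inner_endgame (ε := bareLambda (((1 : ℕ) : ℝ) ^ 3 * β)) (l2_self_nonneg_lat _) hμ0.le hlam0.le hlam0.le hμk2 (hq a) hlt.le hsc
  have e : bareLambda (((1 : ℕ) : ℝ) ^ 3 * β) * bareLambda (((1 : ℕ) : ℝ) ^ 3 * β) = 1 * bareLambda (((1 : ℕ) : ℝ) ^ 3 * β) ^ 2 := by ring
  rw [e] at key
  exact key


end RateTube

end Summit.QuantumFields.YangMills.Theorems.FemtoTransferGap

end
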